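import Summits.QuantumFields.BalabanUV.T4Continuum.Support.ShellMeasureRootCompositionHistoriesSync
import Summits.QuantumFields.BalabanUV.T4Continuum.Support.ShellMeasureRootCompositionSyncToy

/-!
# `T4Continuum.ShellMeasureRootCompositionHistoriesAgeToy` — NON-VACUITY of the END-I OF RECORD for term families:
# `ShellMeasureRootCompositionHistoriesSync.shellWeightBound_histories_age` is JOINTLY INHABITED by ONE explicit data
# set with a GENUINE window (N₁ = 1, both ages populated), COMPUTED shell parts LIVE in BOTH runs, and the two runs'
# tested variables GENUINELY DIFFERENT inside the closeness width
(cell `pub-balaban`, sub-cell `t4`, spine estimate NE7c (node U5b); NE7c ROUND-2 crew `t4-ne7c-formalise-*`, unit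
`b2b-balaban-t4-ne7c-formalise-leaf-06` (gen 2) — idle-seat OFFER in the lane of rows S12/S17/S19 (the (R)+[dict] push,
generalised by row S24 to history-indexed families); imports row S24 file 4 `ShellMeasureRootCompositionHistoriesSync`
(p211878, the END instantiated) and row S27 file 2 `ShellMeasureRootCompositionSyncToy` (p211737: the two-age window
`twoAge_liveWindow` and the uniform law's mass `unif_univ` BY NAME) ONLY; [folklore]; 0 `def`, 0 sorry, 0 cite tags)

HONEST FRAMING.  Finite four-torus programme, rung (B)+1 only — NOT infinite volume, NOT a mass gap, NOT the Clay
problem, NOT summit progress.  NE7c = `T4IndicatorShell.ShellWeightBound` is NOT PRINTED in [Balaban 1983–89] and NOT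
PROVED; «NE7c ⇐ the named binders» (trigger c3).  THIS FILE IS A TOY: its objects are the uniform law on `[0,1]`,
identity and shifted-identity test variables and explicit rational thresholds — NOTHING of Bałaban's measures,
minimisers or effective actions, NO estimate, and NOTHING in the countdown moves.  Its only content is a records
fact about OUR composition (owner's WALL-NE7c-P1 §1): the END-I of record for history-indexed term families,
`shellWeightBound_histories_age` («the node's END-I with the FEWEST displayed binders»), has a binder family —
measurability, `small ⊆ C`, the a.e. two-run CLOSENESS per history (both ways), (M1) per slot per run FOR THE `s`-small
PARTIAL LAWS, `LiveWindow`, `D ≤ D̄`, the rate — that is SIMULTANEOUSLY satisfiable by one data set in a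
NON-DEGENERATE way.  The existing toys do not cover it: row S10 (`ShellMeasureRootCompositionToy`) and row S27 file 2
(`ShellMeasureRootCompositionSyncToy.twoAge_shellWeightBound`) instantiate the ABSTRACT END-I, where the shell parts
`sh` are FREE DATA; here the shell parts are the COMPUTED integrals
`histShell ν (small τ) u^A u^B θ = ∫ Π_s χ(u^A_s < θ_s)·(1 − Π_s χ(u^B_s < θ_s)) dν`, which VANISH identically when
`u^A = u^B` — so a non-degenerate witness must separate the two runs inside the closeness width `ρ_{lvl}·ε(age)` and
still obtain (M1) for BOTH runs' partial laws.  HONEST DEPENDENCY (cell): continuum YM on T⁴ ⇐ BetaPertH ∧ nine spine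
estimates (0/9 proved); BetaPertH ⇐ (D1) ∧ (D4) ∧ CAP+tail; G-an2-4 gates asym, D1 and NE2/3/4.

## The data (all explicit; no definitions)
* spaces `Ω K = ℝ`; histories `T K = Fin 2`; slots `C K = Fin 2`, slot `s` at level `K − s` — row S27 file 2's
  two-age window (`twoAge_liveWindow`: (W1), `N₁ = 1`, `ν̄ = 2`); `small K τ = {τ}`; laws `ν^A = ν^B = volume⌞[0,1]`;
* thresholds BY AGE `ε n = 1/(4(n+1))` (so `θ_{K,s} = ε(K − (K − s)) ∈ (0, 1/4]`); widths `ρ_j = ϑ^j/4`, `0 < ϑ < 1`;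
  constants `D^A = D^B ≡ 2`, `D̄ = 2`, rate `c₁ = 1/4`;
* run A tests `u^A_s(ω) = ω`; run B tests `u^B_s(ω) = ω + σ_s·ρ_{K−s}·ε(age_s)/2` with `σ_0 = +1`, `σ_1 = −1`
  (shifted by HALF the closeness width, up on slot `0`, down on slot `1`).

## What is proved ([folklore])
* §1 `withDensity_smallInd` — a law with ONE kept small-field indicator `χ(u < ϑ)` is the RESTRICTION to `{u < ϑ}`;
  `partialLaw_singletons` — for one-slot histories the `s`-small partial law is `(ν s)⌞{u_s < ϑ_s}`.
* §2 `slotAC_unif_shift` — (M1) with `D = 2` for the shifted variable `ω + a` under `volume⌞[0,1]⌞{ω + a < θ}`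
  (`0 < θ ≤ 1/2`, `|a| ≤ θ/2`, `0 ≤ ρ`); `integral_smallInd_shift` — `∫ χ(ω + a < θ)(1 − χ(ω + b < θ)) = b − a`.
* §3 **`twoAgeHist_shellWeightBound`** — `shellWeightBound_histories_age` FIRES on the data: EVERY binder discharged
  (closeness both ways with the END's own widths; (M1) for both runs' partial laws by §1–§2; (W1) by name; `D ≤ 2`;
  rate), conclusion LITERALLY `ShellWeightBound 0 T (histWeight …) (histWeight …) (histShell …) (histShell …)
  (K ↦ Σ_s 2ρ_{K−s} + Σ_s 2ρ_{K−s})`; `twoAgeHist_weight_pos` — `Wsh K > 0`.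
* §4 **`twoAgeHist_shellA_eq`**, **`twoAgeHist_shellB_eq`**, **`twoAgeHist_shells_pos`** — the COMPUTED shell part of
  run A's history `0` equals run B's upward shift `ρ_K·ε(0)/2 > 0`, that of run B's history `1` equals the downward
  shift `ρ_{K−1}·ε(age₁)/2 > 0`: at EVERY comparison `K` each run has a live shell (run A's history `1` and run B's
  history `0` have shell part `0` — the shifted indicator covers the unshifted one there).

WHAT THIS DOES NOT DO.  Nothing about Bałaban's objects; no binder of the wall (SM-L1…L8, (LR)_j, (W1), node U1b's
rate/closeness) is touched; a TOY inhabitation is NOT evidence for NE7c (referee DV-17); NE7c NOT proved; spine 0/9.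
-/

noncomputable section

open MeasureTheory Set Finset
open scoped ENNReal

namespace Summit.QuantumFields.BalabanUV.T4Continuum.ShellMeasureRootCompositionHistoriesAgeToy

open Literature.MathematicalPhysics.QuantumFieldTheory.Balaban1983to89
open T4IndicatorShell (ShellWeightBound smallInd smallInd_nonneg smallInd_le_one)
open T4ShellMeasure (SlotAntiConcentration)
open ShellMeasureRootCompositionHistories (smallProd histWeight histShell histLaw partialLaw)
open ShellMeasureRootCompositionHistoriesSync (shellWeightBound_histories_age)
open ShellMeasureRootCompositionSyncToy (unif_univ twoAge_liveWindow)

/-! ## §1 Kept indicators as restrictions; the partial law of a one-slot history -/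

section Kept

variable {Ω : Type*} [MeasurableSpace Ω]

omit [MeasurableSpace Ω] in
/-- the kept small-field indicator `χ(u < ϑ)` as an `ℝ≥0∞` density IS the indicator of `{u < ϑ}`. [folklore] -/
theorem ofReal_smallInd_eq_indicator (u : Ω → ℝ) (ϑ : ℝ) :
    (fun ω => ENNReal.ofReal (smallInd (u ω) ϑ)) = {ω | u ω < ϑ}.indicator 1 := by
  funext ω
  unfold T4IndicatorShell.smallInd
  by_cases h : u ω < ϑ
  · rw [if_pos h, Set.indicator_of_mem (show ω ∈ {ω | u ω < ϑ} from h)]; simp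
  · rw [if_neg h, Set.indicator_of_notMem (show ω ∉ {ω | u ω < ϑ} from h)]; simp

/-- the law with the kept indicator of ONE slot is the RESTRICTION to that slot's small-field region. [folklore] -/
theorem withDensity_smallInd (μ : Measure Ω) {u : Ω → ℝ} (hu : Measurable u) (ϑ : ℝ) :
    (μ.withDensity fun ω => ENNReal.ofReal (smallInd (u ω) ϑ)) = μ.restrict {ω | u ω < ϑ} := by
  rw [ofReal_smallInd_eq_indicator, withDensity_indicator_one (measurableSet_lt hu measurable_const)]

/-- for one-slot histories `small τ = {τ}` over the history set `Fin 2`, the `s`-small PARTIAL LAW is the law of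
history `s` with its own indicator kept: `(ν s)⌞{u_s < ϑ_s}`. [folklore] -/
theorem partialLaw_singletons (ν : Fin 2 → Measure Ω) {u : Fin 2 → Ω → ℝ} (hu : ∀ s, Measurable (u s))
    (ϑ : Fin 2 → ℝ) (s : Fin 2) :
    partialLaw (Finset.univ : Finset (Fin 2)) ν (fun τ => ({τ} : Finset (Fin 2))) u ϑ s =
      (ν s).restrict {ω | u s ω < ϑ s} := by
  unfold ShellMeasureRootCompositionHistories.partialLaw ShellMeasureRootCompositionHistories.histLaw
  have hf : (Finset.univ.filter fun τ : Fin 2 => s ∈ ({τ} : Finset (Fin 2))) = {s} := by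
    ext τ; simp [Finset.mem_singleton, eq_comm]
  rw [hf, Finset.sum_singleton]
  have hp : (fun ω => ENNReal.ofReal (smallProd ({s} : Finset (Fin 2)) u ϑ ω)) =
      fun ω => ENNReal.ofReal (smallInd (u s ω) (ϑ s)) := by
    funext ω; simp [ShellMeasureRootCompositionHistories.smallProd]
  rw [hp, withDensity_smallInd _ (hu s)]

end Kept

/-! ## §2 The uniform law on `[0,1]`: (M1) for a SHIFTED variable on its kept region; the shell integral -/

section Uniform

/-- the uniform law on `[0,1]` is finite. [folklore] -/
theorem isFiniteMeasure_unif : IsFiniteMeasure (volume.restrict (Icc (0 : ℝ) 1)) := by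
  refine ⟨?_⟩; rw [unif_univ]; exact ENNReal.one_lt_top

/-- **(M1) WITH `D = 2` FOR THE SHIFTED VARIABLE `ω + a` UNDER THE UNIFORM LAW RESTRICTED TO ITS OWN SMALL-FIELD
REGION `{ω + a < θ}`** (`0 < θ ≤ 1/2`, `|a| ≤ θ/2`, `0 ≤ ρ`): the shell `{θ(1−ρ) ≤ ω + a < θ}` has mass
`≤ θρ`, the region has mass `≥ θ − a ≥ θ/2`. [folklore] -/
theorem slotAC_unif_shift {θ a ρ : ℝ} (hθ0 : 0 < θ) (hθ1 : θ ≤ 1 / 2) (ha : |a| ≤ θ / 2) (hρ0 : 0 ≤ ρ) :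
    SlotAntiConcentration ((volume.restrict (Icc (0 : ℝ) 1)).restrict {ω : ℝ | ω + a < θ}) (fun ω => ω + a)
      θ ρ 2 := by
  have ha1 := (abs_le.1 ha).1
  have ha2 := (abs_le.1 ha).2
  unfold T4ShellMeasure.SlotAntiConcentration
  -- the shell
  have hshell : ((volume.restrict (Icc (0 : ℝ) 1)).restrict {ω : ℝ | ω + a < θ})
      {x : ℝ | θ * (1 - ρ) ≤ x + a ∧ x + a < θ} ≤ ENNReal.ofReal (θ * ρ) := by
    calc ((volume.restrict (Icc (0 : ℝ) 1)).restrict {ω : ℝ | ω + a < θ})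
          {x : ℝ | θ * (1 - ρ) ≤ x + a ∧ x + a < θ}
        ≤ volume {x : ℝ | θ * (1 - ρ) ≤ x + a ∧ x + a < θ} :=
          (Measure.restrict_apply_le _ _).trans (Measure.restrict_apply_le _ _)
      _ = volume (Ico (θ * (1 - ρ) - a) (θ - a)) := by
          congr 1; ext x; simp only [mem_setOf_eq, Set.mem_Ico]; constructor <;> rintro ⟨h1, h2⟩ <;>
            constructor <;> linarith
      _ = ENNReal.ofReal (θ * ρ) := by rw [Real.volume_Ico]; congr 1; ring
  -- the total mass
  have huniv : ENNReal.ofReal (θ / 2) ≤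
      ((volume.restrict (Icc (0 : ℝ) 1)).restrict {ω : ℝ | ω + a < θ}) Set.univ := by
    have hO : MeasurableSet {ω : ℝ | ω + a < θ} := measurableSet_lt (measurable_id.add_const a) measurable_const
    rw [Measure.restrict_apply MeasurableSet.univ, Set.univ_inter, Measure.restrict_apply hO]
    calc ENNReal.ofReal (θ / 2) ≤ ENNReal.ofReal (θ - a) := ENNReal.ofReal_le_ofReal (by linarith)
      _ = volume (Ico (0 : ℝ) (θ - a)) := by rw [Real.volume_Ico, sub_zero]
      _ ≤ volume ({ω : ℝ | ω + a < θ} ∩ Icc (0 : ℝ) 1) := by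
          refine measure_mono fun x hx => ?_
          simp only [Set.mem_Ico] at hx
          exact ⟨by simp only [mem_setOf_eq]; linarith, ⟨hx.1, by linarith⟩⟩
  calc ((volume.restrict (Icc (0 : ℝ) 1)).restrict {ω : ℝ | ω + a < θ})
        {x : ℝ | θ * (1 - ρ) ≤ x + a ∧ x + a < θ}
      ≤ ENNReal.ofReal (θ * ρ) := hshell
    _ = ENNReal.ofReal (2 * ρ) * ENNReal.ofReal (θ / 2) := by
        rw [← ENNReal.ofReal_mul (by linarith)]; congr 1; ring
    _ ≤ ENNReal.ofReal (2 * ρ) * ((volume.restrict (Icc (0 : ℝ) 1)).restrict {ω : ℝ | ω + a < θ}) Set.univ :=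
        mul_le_mul' le_rfl huniv

/-- **THE SHELL INTEGRAL OF TWO SHIFTED COPIES**: `∫ χ(ω + a < θ)·(1 − χ(ω + b < θ)) dU = b − a` for `a ≤ b` with
`[θ − b, θ − a) ⊆ [0,1]` — the integrand is the indicator of `[θ − b, θ − a)`. [folklore] -/
theorem integral_smallInd_shift {θ a b : ℝ} (hab : a ≤ b) (hb : 0 ≤ θ - b) (ha : θ - a ≤ 1) :
    ∫ ω, smallInd (ω + a) θ * (1 - smallInd (ω + b) θ) ∂(volume.restrict (Icc (0 : ℝ) 1)) = b - a := by
  have hind : (fun ω : ℝ => smallInd (ω + a) θ * (1 - smallInd (ω + b) θ)) =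
      (Ico (θ - b) (θ - a)).indicator 1 := by
    funext ω
    simp only [Set.indicator_apply, Set.mem_Ico, Pi.one_apply]
    unfold T4IndicatorShell.smallInd
    by_cases h1 : ω + a < θ
    · by_cases h2 : ω + b < θ
      · rw [if_pos h1, if_pos h2, if_neg (show ¬(θ - b ≤ ω ∧ ω < θ - a) from fun h => by linarith [h.1])]
        ring
      · rw [if_pos h1, if_neg h2, if_pos (show θ - b ≤ ω ∧ ω < θ - a from ⟨by linarith, by linarith⟩)]
        ring
    · rw [if_neg h1, if_neg (show ¬(θ - b ≤ ω ∧ ω < θ - a) from fun h => by linarith [h.2])]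
      ring
  rw [hind, integral_indicator_one measurableSet_Ico, measureReal_def,
    Measure.restrict_apply measurableSet_Ico,
    inter_eq_left.2 (Ico_subset_Icc_self.trans (Icc_subset_Icc hb ha)), Real.volume_Ico,
    ENNReal.toReal_ofReal (by linarith)]
  ring

end Uniform

/-! ## §3 The two-age HISTORY family: one-slot histories over S27 f2's two-age window, run B shifted inside the width -/

section Family
variable {ϑ : ℝ}

/-- the AGE threshold `ε(age) = 1/(4(age+1))` of slot `s` at comparison `K` (age `K − (K − s)`) lies in `(0, 1/4]`.
[folklore] -/
theorem thr_pos_le (K : ℕ) (s : Fin 2) :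
    0 < 1 / (4 * ((((K - (K - (s : ℕ))) : ℕ) : ℝ) + 1)) ∧ 1 / (4 * ((((K - (K - (s : ℕ))) : ℕ) : ℝ) + 1)) ≤ 1 / 4 := by
  have h : (0 : ℝ) ≤ (((K - (K - (s : ℕ))) : ℕ) : ℝ) := Nat.cast_nonneg _
  exact ⟨by positivity, one_div_le_one_div_of_le (by norm_num) (by linarith)⟩

/-- the width `ρ_j = ϑ^j/4` lies in `(0, 1/4]` for `0 < ϑ ≤ 1`. [folklore] -/
theorem width_pos_le (hϑ0 : 0 < ϑ) (hϑ1 : ϑ ≤ 1) (j : ℕ) : 0 < ϑ ^ j / 4 ∧ ϑ ^ j / 4 ≤ 1 / 4 := by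
  have := pow_le_one₀ hϑ0.le hϑ1 (n := j)
  exact ⟨by positivity, by linarith⟩

/-- run B's SHIFT of slot `s` at comparison `K`: UP by half the closeness width `ρ_{K−s}·ε(age)/2` on slot `0`, DOWN
by it on slot `1`; its size is at most half the width and at most half the threshold. [folklore] -/
theorem shift_abs (hϑ0 : 0 < ϑ) (hϑ1 : ϑ ≤ 1) (K : ℕ) (s : Fin 2) :
    |(if (s : ℕ) = 0 then (1 : ℝ) else -1) *
        (ϑ ^ (K - (s : ℕ)) / 4 * (1 / (4 * ((((K - (K - (s : ℕ))) : ℕ) : ℝ) + 1))) / 2)| =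
      ϑ ^ (K - (s : ℕ)) / 4 * (1 / (4 * ((((K - (K - (s : ℕ))) : ℕ) : ℝ) + 1))) / 2 ∧
    ϑ ^ (K - (s : ℕ)) / 4 * (1 / (4 * ((((K - (K - (s : ℕ))) : ℕ) : ℝ) + 1))) / 2 ≤
      ϑ ^ (K - (s : ℕ)) / 4 * (1 / (4 * ((((K - (K - (s : ℕ))) : ℕ) : ℝ) + 1))) ∧
    ϑ ^ (K - (s : ℕ)) / 4 * (1 / (4 * ((((K - (K - (s : ℕ))) : ℕ) : ℝ) + 1))) / 2 ≤
      1 / (4 * ((((K - (K - (s : ℕ))) : ℕ) : ℝ) + 1)) / 2 := by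
  obtain ⟨hρ0, hρ1⟩ := width_pos_le hϑ0 hϑ1 (K - (s : ℕ))
  obtain ⟨hε0, -⟩ := thr_pos_le K s
  have hc0 : 0 ≤ ϑ ^ (K - (s : ℕ)) / 4 * (1 / (4 * ((((K - (K - (s : ℕ))) : ℕ) : ℝ) + 1))) / 2 := by positivity
  refine ⟨?_, by nlinarith, ?_⟩
  · split_ifs
    · rw [one_mul, abs_of_nonneg hc0]
    · rw [neg_one_mul, abs_neg, abs_of_nonneg hc0]
  · have : ϑ ^ (K - (s : ℕ)) / 4 * (1 / (4 * ((((K - (K - (s : ℕ))) : ℕ) : ℝ) + 1))) ≤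
        1 * (1 / (4 * ((((K - (K - (s : ℕ))) : ℕ) : ℝ) + 1))) :=
      mul_le_mul_of_nonneg_right (by linarith) hε0.le
    linarith

/-- **THE END-I OF RECORD FOR TERM FAMILIES FIRES ON THE TWO-AGE HISTORY FAMILY.**  Data (all explicit): spaces
`Ω K = ℝ`; histories `T K = Fin 2`; slots `C K = Fin 2` at levels `K − s` (S27 f2's window: `twoAge_liveWindow`,
`N₁ = 1`, `ν̄ = 2`); one-slot histories `small K τ = {τ}`; both runs' history laws = the uniform law on `[0,1]`;
thresholds BY AGE `ε n = 1/(4(n+1))`; widths `ρ_j = ϑ^j/4`; run A tests `u^A_s(ω) = ω`, run B tests the SHIFTED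
`u^B_s(ω) = ω ± ρ_{K−s}·ε(age_s)/2` (`+` on slot `0`, `−` on slot `1`).  EVERY binder of
`ShellMeasureRootCompositionHistoriesSync.shellWeightBound_histories_age` is DISCHARGED: measurability; `small ⊆ C`;
the a.e. CLOSENESS both ways with the END's own widths `ρ_{lvl}·ε(age)` (the shift is half of it); (M1) with `D = 2`
for BOTH runs' `s`-small PARTIAL LAWS (= the uniform law restricted to the slot's kept region, §1; §2
`slotAC_unif_shift`); (W1); `D ≤ D̄ = 2`; rate `c₁ = 1/4`.  CONCLUSION: LITERALLY `T4IndicatorShell.ShellWeightBound`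
for the COMPUTED term weights `histWeight` and shell parts `histShell` of the family, with
`Wsh K = Σ_s 2ρ_{K−s} + Σ_s 2ρ_{K−s}` (`0 < ϑ < 1`; source radius `l₀ = 0`, i.e. `t = 0` only — the data carry no
source dependence).  A TOY: nothing of Bałaban's; NE7c NOT proved. [folklore] -/
theorem twoAgeHist_shellWeightBound (hϑ0 : 0 < ϑ) (hϑ1 : ϑ < 1) :
    ShellWeightBound 0 (fun _ : ℕ => (Finset.univ : Finset (Fin 2)))
      (fun K _ τ => histWeight (volume.restrict (Icc (0 : ℝ) 1)) ({τ} : Finset (Fin 2))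
        (fun (_ : Fin 2) (ω : ℝ) => ω) (fun s => 1 / (4 * ((((K - (K - (s : ℕ))) : ℕ) : ℝ) + 1))))
      (fun K _ τ => histWeight (volume.restrict (Icc (0 : ℝ) 1)) ({τ} : Finset (Fin 2))
        (fun (s : Fin 2) (ω : ℝ) => ω + (if (s : ℕ) = 0 then (1 : ℝ) else -1) *
          (ϑ ^ (K - (s : ℕ)) / 4 * (1 / (4 * ((((K - (K - (s : ℕ))) : ℕ) : ℝ) + 1))) / 2))
        (fun s => 1 / (4 * ((((K - (K - (s : ℕ))) : ℕ) : ℝ) + 1))))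
      (fun K _ τ => histShell (volume.restrict (Icc (0 : ℝ) 1)) ({τ} : Finset (Fin 2))
        (fun (_ : Fin 2) (ω : ℝ) => ω)
        (fun (s : Fin 2) (ω : ℝ) => ω + (if (s : ℕ) = 0 then (1 : ℝ) else -1) *
          (ϑ ^ (K - (s : ℕ)) / 4 * (1 / (4 * ((((K - (K - (s : ℕ))) : ℕ) : ℝ) + 1))) / 2))
        (fun s => 1 / (4 * ((((K - (K - (s : ℕ))) : ℕ) : ℝ) + 1))))
      (fun K _ τ => histShell (volume.restrict (Icc (0 : ℝ) 1)) ({τ} : Finset (Fin 2))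
        (fun (s : Fin 2) (ω : ℝ) => ω + (if (s : ℕ) = 0 then (1 : ℝ) else -1) *
          (ϑ ^ (K - (s : ℕ)) / 4 * (1 / (4 * ((((K - (K - (s : ℕ))) : ℕ) : ℝ) + 1))) / 2))
        (fun (_ : Fin 2) (ω : ℝ) => ω)
        (fun s => 1 / (4 * ((((K - (K - (s : ℕ))) : ℕ) : ℝ) + 1))))
      (fun K => ∑ s ∈ (Finset.univ : Finset (Fin 2)), 2 * (ϑ ^ (K - (s : ℕ)) / 4) +
        ∑ s ∈ (Finset.univ : Finset (Fin 2)), 2 * (ϑ ^ (K - (s : ℕ)) / 4)) := by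
  haveI : IsFiniteMeasure (volume.restrict (Icc (0 : ℝ) 1)) := isFiniteMeasure_unif
  -- measurability
  have huA : ∀ (K : ℕ) (t : ℝ) (s : Fin 2), Measurable (fun ω : ℝ => ω) := fun _ _ _ => measurable_id
  have huB : ∀ (K : ℕ) (t : ℝ) (s : Fin 2), Measurable (fun ω : ℝ => ω + (if (s : ℕ) = 0 then (1 : ℝ) else -1) *
      (ϑ ^ (K - (s : ℕ)) / 4 * (1 / (4 * ((((K - (K - (s : ℕ))) : ℕ) : ℝ) + 1))) / 2)) :=
    fun _ _ _ => measurable_id.add_const _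
  have hsmall : ∀ K : ℕ, ∀ τ ∈ (Finset.univ : Finset (Fin 2)), ({τ} : Finset (Fin 2)) ⊆ Finset.univ :=
    fun _ _ _ => Finset.subset_univ _
  -- closeness, both ways, with the END's widths
  have hcloseA : ∀ (K : ℕ) (t : ℝ), |t| ≤ 0 → ∀ τ ∈ (Finset.univ : Finset (Fin 2)), ∀ s ∈ ({τ} : Finset (Fin 2)),
      ∀ᵐ ω ∂(volume.restrict (Icc (0 : ℝ) 1)),
        |ω - (ω + (if (s : ℕ) = 0 then (1 : ℝ) else -1) *
          (ϑ ^ (K - (s : ℕ)) / 4 * (1 / (4 * ((((K - (K - (s : ℕ))) : ℕ) : ℝ) + 1))) / 2))| ≤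
          ϑ ^ (K - (s : ℕ)) / 4 * (1 / (4 * ((((K - (K - (s : ℕ))) : ℕ) : ℝ) + 1))) := by
    intro K t _ τ _ s _
    refine Filter.Eventually.of_forall fun ω => ?_
    obtain ⟨habs, hle, -⟩ := shift_abs hϑ0 hϑ1.le K s
    rw [sub_add_cancel_left, abs_neg, habs]
    exact hle
  have hcloseB : ∀ (K : ℕ) (t : ℝ), |t| ≤ 0 → ∀ τ ∈ (Finset.univ : Finset (Fin 2)), ∀ s ∈ ({τ} : Finset (Fin 2)),
      ∀ᵐ ω ∂(volume.restrict (Icc (0 : ℝ) 1)),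
        |(ω + (if (s : ℕ) = 0 then (1 : ℝ) else -1) *
          (ϑ ^ (K - (s : ℕ)) / 4 * (1 / (4 * ((((K - (K - (s : ℕ))) : ℕ) : ℝ) + 1))) / 2)) - ω| ≤
          ϑ ^ (K - (s : ℕ)) / 4 * (1 / (4 * ((((K - (K - (s : ℕ))) : ℕ) : ℝ) + 1))) := by
    intro K t _ τ _ s _
    refine Filter.Eventually.of_forall fun ω => ?_
    obtain ⟨habs, hle, -⟩ := shift_abs hϑ0 hϑ1.le K s
    rw [add_sub_cancel_left, habs]
    exact hle
  have hD0 : ∀ j : ℕ, (0 : ℝ) ≤ (fun _ : ℕ => (2 : ℝ)) j := fun _ => by norm_num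
  have hρ0 : ∀ j : ℕ, (0 : ℝ) ≤ ϑ ^ j / 4 := fun _ => by positivity
  -- (M1) for run A's partial laws: the uniform law on the slot's kept region, identity variable
  have hacA : ∀ (K : ℕ) (t : ℝ), |t| ≤ 0 → ∀ s ∈ (Finset.univ : Finset (Fin 2)),
      SlotAntiConcentration
        (partialLaw (Finset.univ : Finset (Fin 2)) (fun _ => volume.restrict (Icc (0 : ℝ) 1))
          (fun τ => ({τ} : Finset (Fin 2))) (fun (_ : Fin 2) (ω : ℝ) => ω)
          (fun s => 1 / (4 * ((((K - (K - (s : ℕ))) : ℕ) : ℝ) + 1))) s)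
        (fun ω : ℝ => ω) (1 / (4 * ((((K - (K - (s : ℕ))) : ℕ) : ℝ) + 1))) (ϑ ^ (K - (s : ℕ)) / 4)
        ((fun _ : ℕ => (2 : ℝ)) (K - (s : ℕ))) := by
    intro K t _ s _
    rw [partialLaw_singletons (u := fun (_ : Fin 2) (ω : ℝ) => ω) _ (fun _ => measurable_id)]
    obtain ⟨hε0, hε1⟩ := thr_pos_le K s
    simpa using slotAC_unif_shift (a := 0) (ρ := ϑ ^ (K - (s : ℕ)) / 4) hε0 (by linarith)
      (by rw [abs_zero]; linarith) (hρ0 _)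
  -- (M1) for run B's partial laws: the uniform law on the SHIFTED kept region, shifted variable
  have hacB : ∀ (K : ℕ) (t : ℝ), |t| ≤ 0 → ∀ s ∈ (Finset.univ : Finset (Fin 2)),
      SlotAntiConcentration
        (partialLaw (Finset.univ : Finset (Fin 2)) (fun _ => volume.restrict (Icc (0 : ℝ) 1))
          (fun τ => ({τ} : Finset (Fin 2)))
          (fun (s : Fin 2) (ω : ℝ) => ω + (if (s : ℕ) = 0 then (1 : ℝ) else -1) *
            (ϑ ^ (K - (s : ℕ)) / 4 * (1 / (4 * ((((K - (K - (s : ℕ))) : ℕ) : ℝ) + 1))) / 2))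
          (fun s => 1 / (4 * ((((K - (K - (s : ℕ))) : ℕ) : ℝ) + 1))) s)
        (fun ω : ℝ => ω + (if (s : ℕ) = 0 then (1 : ℝ) else -1) *
          (ϑ ^ (K - (s : ℕ)) / 4 * (1 / (4 * ((((K - (K - (s : ℕ))) : ℕ) : ℝ) + 1))) / 2))
        (1 / (4 * ((((K - (K - (s : ℕ))) : ℕ) : ℝ) + 1))) (ϑ ^ (K - (s : ℕ)) / 4)
        ((fun _ : ℕ => (2 : ℝ)) (K - (s : ℕ))) := by
    intro K t _ s _
    rw [partialLaw_singletons (u := fun (s : Fin 2) (ω : ℝ) => ω + (if (s : ℕ) = 0 then (1 : ℝ) else -1) *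
      (ϑ ^ (K - (s : ℕ)) / 4 * (1 / (4 * ((((K - (K - (s : ℕ))) : ℕ) : ℝ) + 1))) / 2)) _
      (fun s => measurable_id.add_const _)]
    obtain ⟨hε0, hε1⟩ := thr_pos_le K s
    obtain ⟨habs, -, hle⟩ := shift_abs hϑ0 hϑ1.le K s
    exact slotAC_unif_shift hε0 (by linarith) (by rw [habs]; linarith) (hρ0 _)
  have hD : ∀ j : ℕ, (fun _ : ℕ => (2 : ℝ)) j ≤ 2 := fun _ => le_rfl
  have hrate : ∀ j : ℕ, ϑ ^ j / 4 ≤ 1 / 4 * ϑ ^ j := fun j => by rw [div_eq_mul_inv, mul_comm]; norm_num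
  exact shellWeightBound_histories_age (Ω := fun _ => ℝ) (T := fun _ : ℕ => (Finset.univ : Finset (Fin 2)))
    (C := fun _ : ℕ => (Finset.univ : Finset (Fin 2))) (small := fun (_ : ℕ) (τ : Fin 2) => ({τ} : Finset (Fin 2)))
    (lvl := fun K (s : Fin 2) => K - (s : ℕ))
    (νA := fun _ _ _ => volume.restrict (Icc (0 : ℝ) 1)) (νB := fun _ _ _ => volume.restrict (Icc (0 : ℝ) 1))
    (uA := fun (K : ℕ) (_ : ℝ) (_ : Fin 2) (ω : ℝ) => ω)
    (uB := fun (K : ℕ) (_ : ℝ) (s : Fin 2) (ω : ℝ) => ω + (if (s : ℕ) = 0 then (1 : ℝ) else -1) *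
      (ϑ ^ (K - (s : ℕ)) / 4 * (1 / (4 * ((((K - (K - (s : ℕ))) : ℕ) : ℝ) + 1))) / 2))
    (ρ := fun j => ϑ ^ j / 4) (DA := fun _ => 2) (DB := fun _ => 2)
    (ε := fun n : ℕ => 1 / (4 * ((n : ℝ) + 1)))
    huA huB hsmall hcloseA hcloseB hD0 hD0 hρ0 hacA hacB twoAge_liveWindow hϑ0 hϑ1 hD hD hrate

/-- … its shell weight `Wsh K` is STRICTLY POSITIVE at every `K`. [folklore] -/
theorem twoAgeHist_weight_pos (hϑ0 : 0 < ϑ) (K : ℕ) :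
    0 < ∑ s ∈ (Finset.univ : Finset (Fin 2)), 2 * (ϑ ^ (K - (s : ℕ)) / 4) +
      ∑ s ∈ (Finset.univ : Finset (Fin 2)), 2 * (ϑ ^ (K - (s : ℕ)) / 4) := by
  have h : 0 < ∑ s ∈ (Finset.univ : Finset (Fin 2)), 2 * (ϑ ^ (K - (s : ℕ)) / 4) :=
    Finset.sum_pos (fun s _ => by positivity) Finset.univ_nonempty
  linarith

/-! ## §4 LIVE SHELLS IN BOTH RUNS: the computed shell parts of history `0` (run A) and history `1` (run B) -/

/-- **RUN A's SHELL PART OF HISTORY `0` IS LIVE**: it EQUALS run B's upward shift `ρ_K·ε(0)/2 > 0` — the mass of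
`{θ₀ − shift ≤ ω < θ₀}`, where run A's slot-`0` indicator is on and run B's is off. [folklore] -/
theorem twoAgeHist_shellA_eq (hϑ0 : 0 < ϑ) (hϑ1 : ϑ ≤ 1) (K : ℕ) :
    histShell (volume.restrict (Icc (0 : ℝ) 1)) ({0} : Finset (Fin 2)) (fun (_ : Fin 2) (ω : ℝ) => ω)
        (fun (s : Fin 2) (ω : ℝ) => ω + (if (s : ℕ) = 0 then (1 : ℝ) else -1) *
          (ϑ ^ (K - (s : ℕ)) / 4 * (1 / (4 * ((((K - (K - (s : ℕ))) : ℕ) : ℝ) + 1))) / 2))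
        (fun s => 1 / (4 * ((((K - (K - (s : ℕ))) : ℕ) : ℝ) + 1))) =
      ϑ ^ (K - ((0 : Fin 2) : ℕ)) / 4 * (1 / (4 * ((((K - (K - ((0 : Fin 2) : ℕ))) : ℕ) : ℝ) + 1))) / 2 := by
  obtain ⟨hε0, hε1⟩ := thr_pos_le K (0 : Fin 2)
  obtain ⟨-, -, hle⟩ := shift_abs hϑ0 hϑ1 K (0 : Fin 2)
  have hc0 : 0 ≤ ϑ ^ (K - ((0 : Fin 2) : ℕ)) / 4 *
      (1 / (4 * ((((K - (K - ((0 : Fin 2) : ℕ))) : ℕ) : ℝ) + 1))) / 2 := by positivity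
  have h := integral_smallInd_shift (θ := 1 / (4 * ((((K - (K - ((0 : Fin 2) : ℕ))) : ℕ) : ℝ) + 1)))
    (a := 0) (b := ϑ ^ (K - ((0 : Fin 2) : ℕ)) / 4 *
      (1 / (4 * ((((K - (K - ((0 : Fin 2) : ℕ))) : ℕ) : ℝ) + 1))) / 2) hc0 (by linarith) (by linarith)
  simp only [ShellMeasureRootCompositionHistories.histShell, ShellMeasureRootCompositionHistories.smallProd,
    Finset.prod_singleton, Fin.val_zero, if_true, one_mul]
  simpa using h

/-- **RUN B's SHELL PART OF HISTORY `1` IS LIVE**: it EQUALS the downward shift `ρ_{K−1}·ε(age₁)/2 > 0` — the mass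
of `{θ₁ ≤ ω < θ₁ + shift}`, where run B's slot-`1` indicator is on and run A's is off. [folklore] -/
theorem twoAgeHist_shellB_eq (hϑ0 : 0 < ϑ) (hϑ1 : ϑ ≤ 1) (K : ℕ) :
    histShell (volume.restrict (Icc (0 : ℝ) 1)) ({1} : Finset (Fin 2))
        (fun (s : Fin 2) (ω : ℝ) => ω + (if (s : ℕ) = 0 then (1 : ℝ) else -1) *
          (ϑ ^ (K - (s : ℕ)) / 4 * (1 / (4 * ((((K - (K - (s : ℕ))) : ℕ) : ℝ) + 1))) / 2))
        (fun (_ : Fin 2) (ω : ℝ) => ω)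
        (fun s => 1 / (4 * ((((K - (K - (s : ℕ))) : ℕ) : ℝ) + 1))) =
      ϑ ^ (K - ((1 : Fin 2) : ℕ)) / 4 * (1 / (4 * ((((K - (K - ((1 : Fin 2) : ℕ))) : ℕ) : ℝ) + 1))) / 2 := by
  obtain ⟨hε0, hε1⟩ := thr_pos_le K (1 : Fin 2)
  obtain ⟨-, -, hle⟩ := shift_abs hϑ0 hϑ1 K (1 : Fin 2)
  have hc0 : 0 ≤ ϑ ^ (K - ((1 : Fin 2) : ℕ)) / 4 *
      (1 / (4 * ((((K - (K - ((1 : Fin 2) : ℕ))) : ℕ) : ℝ) + 1))) / 2 := by positivity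
  have h := integral_smallInd_shift (θ := 1 / (4 * ((((K - (K - ((1 : Fin 2) : ℕ))) : ℕ) : ℝ) + 1)))
    (a := -(ϑ ^ (K - ((1 : Fin 2) : ℕ)) / 4 *
      (1 / (4 * ((((K - (K - ((1 : Fin 2) : ℕ))) : ℕ) : ℝ) + 1))) / 2)) (b := 0) (by linarith) (by linarith)
    (by linarith)
  simp only [ShellMeasureRootCompositionHistories.histShell, ShellMeasureRootCompositionHistories.smallProd,
    Finset.prod_singleton, Fin.val_one, one_ne_zero, if_false, neg_one_mul]
  simpa [← sub_eq_add_neg] using h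

/-- **BOTH RUNS HAVE A LIVE SHELL AT EVERY COMPARISON `K`** (`0 < ϑ ≤ 1`): run A's history `0` and run B's history
`1` have strictly positive computed shell parts — the instance of `shellWeightBound_histories_age` above is
NON-DEGENERATE (the two runs' tested variables genuinely differ, inside the closeness width). [folklore] -/
theorem twoAgeHist_shells_pos (hϑ0 : 0 < ϑ) (hϑ1 : ϑ ≤ 1) (K : ℕ) :
    0 < histShell (volume.restrict (Icc (0 : ℝ) 1)) ({0} : Finset (Fin 2)) (fun (_ : Fin 2) (ω : ℝ) => ω)
        (fun (s : Fin 2) (ω : ℝ) => ω + (if (s : ℕ) = 0 then (1 : ℝ) else -1) *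
          (ϑ ^ (K - (s : ℕ)) / 4 * (1 / (4 * ((((K - (K - (s : ℕ))) : ℕ) : ℝ) + 1))) / 2))
        (fun s => 1 / (4 * ((((K - (K - (s : ℕ))) : ℕ) : ℝ) + 1))) ∧
    0 < histShell (volume.restrict (Icc (0 : ℝ) 1)) ({1} : Finset (Fin 2))
        (fun (s : Fin 2) (ω : ℝ) => ω + (if (s : ℕ) = 0 then (1 : ℝ) else -1) *
          (ϑ ^ (K - (s : ℕ)) / 4 * (1 / (4 * ((((K - (K - (s : ℕ))) : ℕ) : ℝ) + 1))) / 2))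
        (fun (_ : Fin 2) (ω : ℝ) => ω)
        (fun s => 1 / (4 * ((((K - (K - (s : ℕ))) : ℕ) : ℝ) + 1))) := by
  rw [twoAgeHist_shellA_eq hϑ0 hϑ1 K, twoAgeHist_shellB_eq hϑ0 hϑ1 K]
  exact ⟨by positivity, by positivity⟩

end Family

end Summit.QuantumFields.BalabanUV.T4Continuum.ShellMeasureRootCompositionHistoriesAgeToy

end
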